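import Literature.AlgebraicGeometry.Motives.EtaleModCohomologyFunctoriality
import Literature.AlgebraicGeometry.Motives.FrobeniusGalois
import HarnessLib

/-!
# Frobenius and Galois on `R`-linear étale cohomology: `F_Y^* = id`, `ρ(g) = (1 × Spec g)^*`, `F^* = ρ(F_geom)`

The `R`-linear (`Hⁿ(–_ét, R) = Extⁿ(R_X, R_X)`, with cup product) counterparts of
`EtalePullbackOfIso.lean`, `FrobeniusEtale.lean`/`FrobeniusGalois.lean` §Trivial and the
cohomological halves of `EtaleGaloisAction.lean`, `FrobeniusGalois.lean`:

* §Isos (generic coefficients `A`, verbatim port of `EtalePullbackOfIso.lean` §Isos): for an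
  endomorphism `f` with `ε : (U ↦ U ×_f X) ≅ 𝟭` on `X_et`, `etaleInverseImageIsoOfIso f A ε : f^* ≅ 𝟭`
  and its coherence with `f^* M ≅ M`;
* `etaleModCohomologyMap_eq_self_of_iso`: such `f` act as the identity on `Hⁿ(X_ét, R)` (one line
  from `Ext.mapExactFunctor_functorIso`); hence the absolute Frobenius and its powers act trivially
  (`etaleModCohomologyMap_absoluteFrobenius`, `_powEndo_prime_pow`; Milne VI 13.2, SGA 5 XV §2);
* `geometricEtaleModCohomologyRep X R n : Gal(k̄/k) →* End_R(Hⁿ((X_{k̄})_ét, R))`, `ρ(g) = (1 × Spec g)^*`,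
  multiplicative for the cup product and equivariant for pull-backs (Deligne, Weil I (1.15));
* `etaleModCohomologyMap_frobenius_eq_geomFrob`: `F^* = ρ(F_geom)` for `F = F_{X/k} × 1`
  (Deligne (1.15.1); Milne VI §13 `F_{X̄} = (1 × φ)(F × 1)` is the tree's
  `geometricFibreFrobenius_eq_comp`).

## References

* P. Deligne, *La conjecture de Weil. I*, Publ. Math. IHÉS 43 (1974), (1.15), (1.15.1). [Deligne1974]
* J. S. Milne, *Étale cohomology* (reissue 2025; held copy): VI §13, Lemma 13.2 (p. 300).
  [Milne2025]
-/

universe u' u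

open CategoryTheory CategoryTheory.Limits AlgebraicGeometry Opposite CategoryTheory.Abelian

namespace Literature.AlgebraicGeometry.Motives

section GenericA

variable {X : Scheme.{u}} (f : X ⟶ X)

variable (A : Type u') [Category.{u} A] {FA : A → A → Type*} {CA : A → Type u}
  [∀ P Q, FunLike (FA P Q) (CA P) (CA Q)] [ConcreteCategory.{u} A FA]
  [PreservesLimits (forget A)] [HasColimits A] [HasLimits A]
  [(forget A).ReflectsIsomorphisms] [PreservesFilteredColimitsOfSize.{u, u} (forget A)]
  [Abelian A] [IsGrothendieckAbelian.{u} A]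

variable (ε : etaleBaseChange f ≅ 𝟭 X.Etale)

/-! ### `f_* ≅ 𝟭` and `f^* ≅ 𝟭` from `ε` -/

section Isos

/-- **`f_* ≅ 𝟭`** when base change along `f` is isomorphic to the identity of `X_et`
(`(f_* P)(U) = P(U ×_f X) ≅ P(U)`). [folklore] -/
noncomputable def etalePushforwardIsoOfIso' : etalePushforward f A ≅ 𝟭 _ :=
  Functor.sheafPushforwardContinuousId' ε A X.smallEtaleTopology

omit [HasColimits A] [HasLimits A] [Abelian A] [IsGrothendieckAbelian.{u} A] in
/-- Components of `etalePushforwardIsoOfIso'`: `P(U) → (f_* P)(U) = P(U ×_f X)` is restriction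
along `ε_U : U ×_f X ⥲ U`. [folklore] -/
theorem etalePushforwardIsoOfIso'_inv_app_hom_app (P : Sheaf X.smallEtaleTopology A)
    (U : X.Etale) :
    ((etalePushforwardIsoOfIso' f A ε).inv.app P).hom.app (op U) = P.obj.map (ε.hom.app U).op := by
  simp [etalePushforwardIsoOfIso', Functor.sheafPushforwardContinuousId',
    Functor.sheafPushforwardContinuousId, Functor.sheafPushforwardContinuousIso]
  exact Category.id_comp _

/-- **`f^* ≅ 𝟭`**, the isomorphism of left adjoints conjugate to `etalePushforwardIsoOfIso'`
(Mathlib `Adjunction.leftAdjointIdIso`). [folklore] -/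
noncomputable def etaleInverseImageIsoOfIso : etaleInverseImage f A ≅ 𝟭 _ :=
  (etaleInverseImageAdjunction f A).leftAdjointIdIso (etalePushforwardIsoOfIso' f A ε)

/-- `etaleInverseImageIsoOfIso` is conjugate to `etalePushforwardIsoOfIso'`. [folklore] -/
theorem conjugateEquiv_etaleInverseImageIsoOfIso_hom :
    conjugateEquiv .id (etaleInverseImageAdjunction f A) (etaleInverseImageIsoOfIso f A ε).hom =
      (etalePushforwardIsoOfIso' f A ε).inv :=
  Adjunction.conjugateEquiv_leftAdjointIdIso_hom _ _

set_option backward.isDefEq.respectTransparency false in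
/-- The unit relation defining `etaleInverseImageIsoOfIso`: `η_f(U) ≫ u_P(U ×_f X) = (restriction
along ε_U)`. [folklore] -/
theorem unit_app_comp_etaleInverseImageIsoOfIso_hom_app (P : Sheaf X.smallEtaleTopology A)
    (U : X.Etale) :
    ((etaleInverseImageAdjunction f A).unit.app P).hom.app (op (U)) ≫
        ((etaleInverseImageIsoOfIso f A ε).hom.app P).hom.app (op ((etaleBaseChange f).obj U)) =
      P.obj.map (ε.hom.app U).op := by
  have h := unit_conjugateEquiv Adjunction.id (etaleInverseImageAdjunction f A)
    (etaleInverseImageIsoOfIso f A ε).hom P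
  rw [conjugateEquiv_etaleInverseImageIsoOfIso_hom] at h
  have h' := Sheaf.congr_hom_app h (op U)
  have e1 : (((Adjunction.id (C := Sheaf X.smallEtaleTopology A)).unit.app P) ≫
      (etalePushforwardIsoOfIso' f A ε).inv.app P).hom.app (op U) =
      P.obj.map (ε.hom.app U).op := by
    rw [← etalePushforwardIsoOfIso'_inv_app_hom_app]
    exact Category.id_comp _
  exact h'.symm.trans e1

variable (M : A)

set_option backward.isDefEq.respectTransparency false in
/-- **Compatibility with `π^* M ≅ M`**: on `M_X`, `etaleInverseImageIsoOfIso` is the constant-sheaf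
isomorphism `f^* M_X ≅ M_X`. [folklore] -/
theorem etaleInverseImageIsoOfIso_hom_app_constantSheaf :
    (etaleInverseImageIsoOfIso f A ε).hom.app ((constantSheaf X.smallEtaleTopology A).obj M) =
      (etaleInverseImageConstantSheafIso f A M).hom := by
  rw [← Iso.inv_comp_eq_id]
  apply constantSheaf_hom_ext (isTerminalEtaleBaseChangeObjMkId f)
  change constantSection X.smallEtaleTopology M ((etaleBaseChange f).obj (Scheme.Etale.mk (𝟙 X))) ≫
      ((etaleInverseImageConstantSheafIso f A M).inv).hom.app (op ((etaleBaseChange f).obj (Scheme.Etale.mk (𝟙 X)))) ≫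
      ((etaleInverseImageIsoOfIso f A ε).hom.app ((constantSheaf X.smallEtaleTopology A).obj M)).hom.app (op ((etaleBaseChange f).obj (Scheme.Etale.mk (𝟙 X)))) =
    constantSection X.smallEtaleTopology M ((etaleBaseChange f).obj (Scheme.Etale.mk (𝟙 X))) ≫ 𝟙 _
  rw [Category.comp_id]
  have L1 := constantSection_comp_unit_comp_inverseImageConstantSheafIso f A M (Scheme.Etale.mk (𝟙 X))
  have hinv : ((etaleInverseImageConstantSheafIso f A M).hom).hom.app (op ((etaleBaseChange f).obj (Scheme.Etale.mk (𝟙 X)))) ≫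
      ((etaleInverseImageConstantSheafIso f A M).inv).hom.app (op ((etaleBaseChange f).obj (Scheme.Etale.mk (𝟙 X)))) = 𝟙 _ :=
    Sheaf.congr_hom_app (etaleInverseImageConstantSheafIso f A M).hom_inv_id (op ((etaleBaseChange f).obj (Scheme.Etale.mk (𝟙 X))))
  have hinv' : ((etaleInverseImageAdjunction f A).unit.app ((constantSheaf X.smallEtaleTopology A).obj M)).hom.app (op (Scheme.Etale.mk (𝟙 X))) ≫
      ((etaleInverseImageConstantSheafIso f A M).hom).hom.app (op ((etaleBaseChange f).obj (Scheme.Etale.mk (𝟙 X)))) ≫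
      ((etaleInverseImageConstantSheafIso f A M).inv).hom.app (op ((etaleBaseChange f).obj (Scheme.Etale.mk (𝟙 X)))) =
      ((etaleInverseImageAdjunction f A).unit.app ((constantSheaf X.smallEtaleTopology A).obj M)).hom.app (op (Scheme.Etale.mk (𝟙 X))) := by
    rw [hinv]; exact Category.comp_id _
  have s1 : constantSection X.smallEtaleTopology M ((etaleBaseChange f).obj (Scheme.Etale.mk (𝟙 X))) ≫
      ((etaleInverseImageConstantSheafIso f A M).inv).hom.app (op ((etaleBaseChange f).obj (Scheme.Etale.mk (𝟙 X)))) =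
      constantSection X.smallEtaleTopology M (Scheme.Etale.mk (𝟙 X)) ≫ ((etaleInverseImageAdjunction f A).unit.app ((constantSheaf X.smallEtaleTopology A).obj M)).hom.app (op (Scheme.Etale.mk (𝟙 X))) := by
    rw [← L1]; simp only [Category.assoc]; rw [hinv']
  have s2 : ((etaleInverseImageAdjunction f A).unit.app ((constantSheaf X.smallEtaleTopology A).obj M)).hom.app (op (Scheme.Etale.mk (𝟙 X))) ≫
      ((etaleInverseImageIsoOfIso f A ε).hom.app ((constantSheaf X.smallEtaleTopology A).obj M)).hom.app (op ((etaleBaseChange f).obj (Scheme.Etale.mk (𝟙 X)))) =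
      ((constantSheaf X.smallEtaleTopology A).obj M).obj.map (ε.hom.app (Scheme.Etale.mk (𝟙 X))).op :=
    unit_app_comp_etaleInverseImageIsoOfIso_hom_app f A ε ((constantSheaf X.smallEtaleTopology A).obj M) (Scheme.Etale.mk (𝟙 X))
  have s3 : constantSection X.smallEtaleTopology M (Scheme.Etale.mk (𝟙 X)) ≫ ((constantSheaf X.smallEtaleTopology A).obj M).obj.map (ε.hom.app (Scheme.Etale.mk (𝟙 X))).op =
      constantSection X.smallEtaleTopology M ((etaleBaseChange f).obj (Scheme.Etale.mk (𝟙 X))) :=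
    constantSection_comp_map X.smallEtaleTopology M (ε.hom.app (Scheme.Etale.mk (𝟙 X)))
  calc constantSection X.smallEtaleTopology M ((etaleBaseChange f).obj (Scheme.Etale.mk (𝟙 X))) ≫
      ((etaleInverseImageConstantSheafIso f A M).inv).hom.app (op ((etaleBaseChange f).obj (Scheme.Etale.mk (𝟙 X)))) ≫
      ((etaleInverseImageIsoOfIso f A ε).hom.app ((constantSheaf X.smallEtaleTopology A).obj M)).hom.app (op ((etaleBaseChange f).obj (Scheme.Etale.mk (𝟙 X))))
      = (constantSection X.smallEtaleTopology M ((etaleBaseChange f).obj (Scheme.Etale.mk (𝟙 X))) ≫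
          ((etaleInverseImageConstantSheafIso f A M).inv).hom.app (op ((etaleBaseChange f).obj (Scheme.Etale.mk (𝟙 X))))) ≫
          ((etaleInverseImageIsoOfIso f A ε).hom.app ((constantSheaf X.smallEtaleTopology A).obj M)).hom.app (op ((etaleBaseChange f).obj (Scheme.Etale.mk (𝟙 X)))) := by simp only [Category.assoc]
    _ = (constantSection X.smallEtaleTopology M (Scheme.Etale.mk (𝟙 X)) ≫ ((etaleInverseImageAdjunction f A).unit.app ((constantSheaf X.smallEtaleTopology A).obj M)).hom.app (op (Scheme.Etale.mk (𝟙 X)))) ≫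
          ((etaleInverseImageIsoOfIso f A ε).hom.app ((constantSheaf X.smallEtaleTopology A).obj M)).hom.app (op ((etaleBaseChange f).obj (Scheme.Etale.mk (𝟙 X)))) := by rw [s1]
    _ = constantSection X.smallEtaleTopology M (Scheme.Etale.mk (𝟙 X)) ≫ (((etaleInverseImageAdjunction f A).unit.app ((constantSheaf X.smallEtaleTopology A).obj M)).hom.app (op (Scheme.Etale.mk (𝟙 X))) ≫
          ((etaleInverseImageIsoOfIso f A ε).hom.app ((constantSheaf X.smallEtaleTopology A).obj M)).hom.app (op ((etaleBaseChange f).obj (Scheme.Etale.mk (𝟙 X))))) := by simp only [Category.assoc]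
    _ = constantSection X.smallEtaleTopology M (Scheme.Etale.mk (𝟙 X)) ≫ ((constantSheaf X.smallEtaleTopology A).obj M).obj.map (ε.hom.app (Scheme.Etale.mk (𝟙 X))).op := by rw [s2]
    _ = constantSection X.smallEtaleTopology M ((etaleBaseChange f).obj (Scheme.Etale.mk (𝟙 X))) := s3

end Isos

end GenericA

/-! ### `f^* = id` on `Hⁿ(X_ét, R)` for site-trivial endomorphisms -/

section ModCohomology

variable {X : Scheme.{u}} (f : X ⟶ X)

set_option backward.isDefEq.respectTransparency false in
/-- **`f^* = id` on `Hⁿ(X_ét, R)`** for an endomorphism `f` whose base change is isomorphic to the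
identity of `X_et` (`Ext.mapExactFunctor_functorIso` for `f^* ≅ 𝟭` plus the coherence with
`f^* R_X ≅ R_X`). [cite: Milne2025, VI Lemma 13.2] -/
theorem etaleModCohomologyMap_eq_self_of_iso (ε : etaleBaseChange f ≅ 𝟭 X.Etale) (R : Type u)
    [CommRing R] (n : ℕ) (x : etaleModCohomology X R n) :
    etaleModCohomologyMap f R n x = x := by
  have h := Ext.mapExactFunctor_functorIso (etaleInverseImageIsoOfIso f (ModuleCat.{u} R) ε) x
  rw [Ext.mapExactFunctor_functorId] at h
  have hι : (etaleInverseImageSelfIso f R).inv =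
      (etaleInverseImageIsoOfIso f (ModuleCat.{u} R) ε).inv.app
        (constantSheafSelf X.smallEtaleTopology R) := by
    rw [← Iso.app_inv, Iso.inv_eq_inv]
    exact (etaleInverseImageIsoOfIso_hom_app_constantSheaf f (ModuleCat.{u} R) ε
      (ModuleCat.of R R)).symm
  rw [etaleModCohomologyMap, linearCohomologyMap_apply,
    ← etaleInverseImageIsoOfIso_hom_app_constantSheaf f (ModuleCat.{u} R) ε,
    linearCohomologyPullback_apply, linearCohomology.map_apply, Ext.comp_assoc_of_third_deg_zero, hι]
  exact h

end ModCohomology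

/-! ### The Frobenius acts trivially on `Hⁿ(Y_ét, R)` -/

section Trivial

variable (p : ℕ) [Fact p.Prime] {Y : Scheme.{u}}

/-- **The absolute Frobenius acts as the identity on `Hⁱ(Y_ét, R)`** (SGA 5 XV §2; Milne VI §13,
from Lemma 13.2): `F_Y^* = id`, since base change along `F_Y` is isomorphic to the identity of the
étale site (`etaleBaseChangeAbsoluteFrobeniusIso`) and such pull-backs are the identity
(`etaleModCohomologyMap_eq_self_of_iso`). [cite: Milne2025, VI Lemma 13.2] -/
theorem etaleModCohomologyMap_absoluteFrobenius (hY : (p : Γ(Y, ⊤)) = 0) (R : Type u) [CommRing R] (i : ℕ)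
    (x : etaleModCohomology Y R i) :
    etaleModCohomologyMap (absoluteFrobenius Y p hY) R i x = x :=
  etaleModCohomologyMap_eq_self_of_iso _ (etaleBaseChangeAbsoluteFrobeniusIso p hY) R i x

set_option backward.isDefEq.respectTransparency false in
/-- `etaleModCohomologyMap_absoluteFrobenius` for `powEndo Y p` with an arbitrary additivity witness
(the absolute Frobenius up to proof irrelevance). [cite: Milne2025, VI Lemma 13.2] -/
theorem etaleModCohomologyMap_powEndo_prime (hY : (p : Γ(Y, ⊤)) = 0) (R : Type u) [CommRing R] (i : ℕ) (hp : p ≠ 0)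
    (hadd : ∀ (U : Y.Opens) (a b : Γ(Y, U)), (a + b) ^ p = a ^ p + b ^ p)
    (x : etaleModCohomology Y R i) :
    etaleModCohomologyMap (powEndo Y p hp hadd) R i x = x :=
  etaleModCohomologyMap_eq_self_of_iso _ (etaleBaseChangeAbsoluteFrobeniusIso p hY) R i x

/-- **The `pʳ⁺¹`-power Frobenius acts as the identity on `Hⁱ(Y_ét, R)`**: it is the `(r+1)`-fold
iterate of the absolute Frobenius (`powEndo_comp_powEndo`). [cite: Milne2025, VI Lemma 13.2] -/
theorem etaleModCohomologyMap_powEndo_prime_pow (hY : (p : Γ(Y, ⊤)) = 0) (R : Type u) [CommRing R] (i : ℕ) (r : ℕ)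
    (hn : p ^ (r + 1) ≠ 0)
    (hadd : ∀ (U : Y.Opens) (a b : Γ(Y, U)), (a + b) ^ p ^ (r + 1) = a ^ p ^ (r + 1) + b ^ p ^ (r + 1))
    (x : etaleModCohomology Y R i) :
    etaleModCohomologyMap (powEndo Y (p ^ (r + 1)) hn hadd) R i x = x := by
  induction r generalizing x with
  | zero =>
    rw [powEndo_congr (Y := Y) (show p ^ (0 + 1) = p by rw [zero_add, pow_one]) hn
      (Fact.out : p.Prime).ne_zero hadd (add_pow_prime_pow_sections p hY 1 · · · |> fun h => by
        simpa only [pow_one] using h)]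
    exact etaleModCohomologyMap_powEndo_prime p hY R i _ _ x
  | succ r ih =>
    rw [← powEndo_congr (Y := Y) (pow_succ p (r + 1)).symm
      (mul_ne_zero (pow_ne_zero _ (Fact.out : p.Prime).ne_zero) (Fact.out : p.Prime).ne_zero) hn
      (fun U a b => by simpa only [← pow_succ] using hadd U a b) hadd,
      ← powEndo_comp_powEndo Y p (Fact.out : p.Prime).ne_zero
        (add_pow_prime_pow_sections p hY 1 · · · |> fun h => by simpa only [pow_one] using h)
        (p ^ (r + 1)) (pow_ne_zero _ (Fact.out : p.Prime).ne_zero)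
        (add_pow_prime_pow_sections p hY (r + 1)),
      etaleModCohomologyMap_comp, etaleModCohomologyMap_powEndo_prime p hY R i]
    exact ih (pow_ne_zero _ (Fact.out : p.Prime).ne_zero) _ x

end Trivial

/-! ### The Galois representation on `Hⁿ((X_{k̄})_ét, R)` and `F^* = ρ(F_geom)` -/

section Galois

variable {k : Type u} [Field k] (X : SchemeOver k) (R : Type u) [CommRing R] (n : ℕ)

/-- **`Hⁿ((X_{k̄})_ét, R)`**, the `R`-linear étale cohomology (with cup product) of the geometric fibre.
[folklore] -/
abbrev geometricEtaleModCohomology : Type u :=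
  etaleModCohomology (geometricFibre k X) R n

/-- **The Galois representation `ρ : Gal(k̄/k) →* End_R(Hⁿ((X_{k̄})_ét, R))`, `ρ(g) = (1 × Spec g)^*`**
("par transport de structure", Deligne, Weil I (1.15)); a homomorphism because `g ↦ 1 × Spec g` is a
right action (`geometricFibreMap_one/_mul`) and `Hⁿ(–_ét, R)` is contravariant
(`etaleModCohomologyMap_comp/_id`). [cite: Deligne1974, (1.15)] -/
noncomputable def geometricEtaleModCohomologyRep :
    Field.absoluteGaloisGroup k →* Module.End R (geometricEtaleModCohomology X R n) where
  toFun g := etaleModCohomologyMap (geometricFibreMap X g) R n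
  map_one' := by
    apply LinearMap.ext
    intro x
    change etaleModCohomologyMap (geometricFibreMap X 1) R n x = x
    rw [geometricFibreMap_one]
    exact etaleModCohomologyMap_id R n x
  map_mul' g h := by
    apply LinearMap.ext
    intro x
    change etaleModCohomologyMap (geometricFibreMap X (g * h)) R n x =
      etaleModCohomologyMap (geometricFibreMap X g) R n
        (etaleModCohomologyMap (geometricFibreMap X h) R n x)
    rw [geometricFibreMap_mul]
    exact etaleModCohomologyMap_comp _ _ R n x

/-- `ρ(g) = (1 × Spec g)^*` (by `rfl`). [folklore] -/
theorem geometricEtaleModCohomologyRep_apply (g : Field.absoluteGaloisGroup k)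
    (x : geometricEtaleModCohomology X R n) :
    geometricEtaleModCohomologyRep X R n g x = etaleModCohomologyMap (geometricFibreMap X g) R n x :=
  rfl

/-- **The Galois action is multiplicative**: `ρ(g)(x ∪ y) = ρ(g)x ∪ ρ(g)y`. [folklore] -/
theorem geometricEtaleModCohomologyRep_cup (g : Field.absoluteGaloisGroup k) {i j m : ℕ}
    (h : i + j = m) (x : geometricEtaleModCohomology X R i) (y : geometricEtaleModCohomology X R j) :
    geometricEtaleModCohomologyRep X R m g (linearCohomology.cup h x y) =
      linearCohomology.cup h (geometricEtaleModCohomologyRep X R i g x)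
        (geometricEtaleModCohomologyRep X R j g y) :=
  etaleModCohomologyMap_cup _ R h x y

variable {X} in
/-- **Pull-backs are Galois equivariant.** [folklore] -/
theorem geometricEtaleModCohomologyRep_pullback {X' : SchemeOver k} (φ : X ⟶ X')
    (g : Field.absoluteGaloisGroup k) (y : geometricEtaleModCohomology X' R n) :
    geometricEtaleModCohomologyRep X R n g (etaleModCohomologyMap (geometricFibreHom φ) R n y) =
      etaleModCohomologyMap (geometricFibreHom φ) R n (geometricEtaleModCohomologyRep X' R n g y) := by
  rw [geometricEtaleModCohomologyRep_apply, geometricEtaleModCohomologyRep_apply,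
    ← etaleModCohomologyMap_comp, ← etaleModCohomologyMap_comp, geometricFibreMap_comp_geometricFibreHom]

variable [Finite k]

/-- **The `q`-Frobenius of `X_{k̄}` acts as the identity on `Hⁿ((X_{k̄})_ét, R)`.**
[cite: Milne2025, VI Lemma 13.2] -/
theorem etaleModCohomologyMap_geometricFibreFrobenius (x : geometricEtaleModCohomology X R n) :
    etaleModCohomologyMap (geometricFibreFrobenius X) R n x = x := by
  letI := Fintype.ofFinite k
  obtain ⟨m, hp, hm⟩ := FiniteField.card k (ringChar k)
  haveI : Fact (ringChar k).Prime := ⟨hp⟩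
  have hq : Nat.card k = ringChar k ^ ((m : ℕ) - 1 + 1) := by
    rw [Nat.sub_add_cancel m.pos, Nat.card_eq_fintype_card, hm]
  have hY : (ringChar k : Γ(geometricFibre k X, ⊤)) = 0 :=
    natCast_ringChar_sections (geometricFibreOver X) ⊤
  rw [geometricFibreFrobenius_eq_powEndo,
    powEndo_congr (Y := geometricFibre k X) hq card_ne_zero
      (pow_ne_zero _ hp.ne_zero) (add_pow_card_sections (geometricFibreOver X))
      (add_pow_prime_pow_sections (ringChar k) hY _)]
  exact etaleModCohomologyMap_powEndo_prime_pow (ringChar k) hY R n _ _ _ x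

/-- **Deligne (1.15.1), `F^* ∘ φ = id` on `Hⁿ((X_{k̄})_ét, R)`.** [cite: Deligne1974, (1.15.1)] -/
theorem etaleModCohomologyMap_frobenius_comp_arithFrob (x : geometricEtaleModCohomology X R n) :
    etaleModCohomologyMap (geometricFibreHom (frobeniusOver X)) R n
        (geometricEtaleModCohomologyRep X R n (arithFrob k) x) = x := by
  rw [geometricEtaleModCohomologyRep_apply, ← etaleModCohomologyMap_comp,
    ← geometricFibreFrobenius_eq_comp]
  exact etaleModCohomologyMap_geometricFibreFrobenius X R n x

/-- **`F^* = ρ(F_geom)` on `Hⁿ((X_{k̄})_ét, R)`** (Deligne, Weil I (1.15.1): "`F^* = φ⁻¹` …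
`F^* = F`"). [cite: Deligne1974, (1.15.1)] -/
theorem etaleModCohomologyMap_frobenius_eq_geomFrob (x : geometricEtaleModCohomology X R n) :
    etaleModCohomologyMap (geometricFibreHom (frobeniusOver X)) R n x =
      geometricEtaleModCohomologyRep X R n (geomFrob k) x := by
  have h := etaleModCohomologyMap_frobenius_comp_arithFrob X R n
    (geometricEtaleModCohomologyRep X R n (geomFrob k) x)
  have e : geometricEtaleModCohomologyRep X R n (arithFrob k)
      (geometricEtaleModCohomologyRep X R n (geomFrob k) x) = x := by
    change (geometricEtaleModCohomologyRep X R n (arithFrob k) *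
      geometricEtaleModCohomologyRep X R n (geomFrob k)) x = x
    rw [← map_mul, ← geomFrob_inv, inv_mul_cancel, map_one]
    rfl
  rw [e] at h
  exact h

end Galois

end Literature.AlgebraicGeometry.Motives
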